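import Summits.QuantumFields.BalabanUV.Beta.FP.BlockAveragedRemainderWindow

/-!
# Road FP (binder row D1), row H′2-IR — IR-Q SUPPLEMENT (R-FP-20) PART 2: THE WINDOW FORM (T2-win) OF `R^Q = A·G_C·Aᵀ` AT BAŁABAN's
# STRAIGHT-CONTOUR AVERAGE — `Σ_{q∈box 4 n} |Δ_νΔ_μ R^Q((n•w+q,μ′),(y,ν′))| ≤ 4·162·(9·82944·C₁)·K_W`, LOG-FREE, from the leg's FIRST-difference letter (P1)
# and the coarse-inverse letters of IR-2 (displayed); the four-term window lemma and the re-centring of the window's legs (our bookkeeping)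

HONEST DEPENDENCY (page 1, mandatory): continuum YM on T⁴ ⇐ BetaPertH ∧ nine spine estimates (0/9 proved); BetaPertH ⇐ (D1) ∧ (D4) ∧
CAP+tail; G-an2-4 gates asym, D1 and NE2/3/4.  HONEST FRAMING (cell contract, verbatim): «discharging `BetaPertH` makes Bałaban's UV
stability UNCONDITIONAL — a real constructive-QFT result; it is NOT the continuum limit and NOT the Clay problem.»  THIS MODULE is
[folklore]∕our bookkeeping on `ℤ⁴` over PART 1 `FP/BlockAveragedRemainderWindow` (the degree-`s` window lemma `sum_abs_sum_rem_le_of_window'`, the axial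
window letter `sum_box_abs_axialAvg_fwdDiff₂_le_profile`) and IR-Q PART B `FP/BlockAveragedRemainderAxial` (`leg_letter`, `abs_multQ_le`), BY NAME; it cites
nothing, declares no `def`, mints no `def … : Prop`, has 0 `sorry`.  `P` and `G` are ARBITRARY with displayed letters ((P0), (P1); (G-poly), (G-inv) = IR-2 (iv)(v));
the `P^{BF} := Re PinfKer` instance is `FP/BlockAveragedPropagatorWindow`.  It discharges NOTHING of row H′2-IR ∕ `ρ_a` ∕ `hasym` ∕ D1 ∕ `BetaPertH`; NEVER
«G-an2-4 closed»; NOT (CONV-C), NOT D1, NOT the continuum limit, NOT Clay.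

ABSOLUTE RULE (cell charter, verbatim): «No internally-minted statement may enter as a cited fact. Every hypothesis is either
kernel-proved in this package or a verbatim quotation of a PUBLISHED theorem with page reference. The manuscript(s) under audit are NOT
citable for their own disputed steps — they are the thing under adjudication; programme-internal (2001/route/tribunal) claims are never
citable.»

CONTENT. §1 `sum_abs_rem_four_le_of_window` (four legs with degree-2 letters at a common centre, a degree-`s` window letter for `l₁ − l₂ − l₃ + l₄`, a
degree-3 multiplier letter ⟹ `Σ_{x∈X}|R₁ − R₂ − R₃ + R₄| ≤ |ι|·162·aW·K`); `quo_nsmul_add`, `supNorm_quo_le_three`, `letter_recentre` (a window leg's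
degree-2 letter centred at its own block is one centred at the window's block with `16×` the constant), unit-shift norms; §2 **`sum_box_abs_remQ_fwdDiff₂_le`**:
under (P0), (P1), (G-poly κ), (G-inv), `Σ_{q∈box 4 n} |Δ_νΔ_μ R^Q((n•w+q, μ′),(y,ν′))| ≤ 4·162·(9·82944·C₁)·(4·1296·κ·(13824·531442·C₁∕n²) + 1)` —
`O(1)` at `κ ≍ n²` (R-FP-20: `n⁴` window points × `O(n⁻⁴)`), log-free, from (P1) alone.
Unit `b2b-balaban-gan24-formalise-leaf-04` (gen 40; cross-lane idle G-an2-4 swarm leaf seat on road FP), 2026-08-20; row IR-Q (l.236) of `LEAVES-FP.md`.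
-/

namespace Summit.QuantumFields.BalabanUV.Beta.FP.BlockAveragedRemainderWindowAxial

open Finset
open scoped BigOperators
open Literature.Probability.LatticeModels (box)
open Literature.MathematicalPhysics.QuantumFieldTheory.Balaban1983to89.Beta
open Literature.MathematicalPhysics.QuantumFieldTheory.Balaban1983to89.Beta.DyadicShell (Pt supNorm mem_box_iff supNorm_le_iff natAbs_le_supNorm
  natAbs_le_iff_mem supNorm_eq_zero_iff)
open Literature.MathematicalPhysics.QuantumFieldTheory.Balaban1983to89.Beta.GradedBubbles (supNorm_neg)
open Literature.MathematicalPhysics.QuantumFieldTheory.Balaban1983to89.Beta.AxialComposition (axialAvg)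
open Literature.MathematicalPhysics.QuantumFieldTheory.LatticeForm (quo)
open Summit.QuantumFields.BalabanUV.Beta.FP.LatticeConvolutionBounds (nonneg_of_abs_le_div one_le_supNorm_add_one)
open Summit.QuantumFields.BalabanUV.Beta.FP.BlockAveragedKernel (letter_nonneg_of_le supNorm_le_supNorm_sub_add)
open Summit.QuantumFields.BalabanUV.Beta.FP.BlockAveragedRemainder (abs_tsum_sum_mul_le tsum_sum_abs_mul_le)
open Summit.QuantumFields.BalabanUV.Beta.FP.BlockAveragedRemainderAxial (leg_letter abs_multQ_le)
open Summit.QuantumFields.BalabanUV.Beta.FP.BlockAveragedRemainderWindow (sum_abs_sum_rem_le_of_window' sum_box_abs_axialAvg_fwdDiff₂_le_profile)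

noncomputable section

variable {ι : Type*} [Fintype ι]

/-! ## §1 The four-term window lemma and the re-centring of the window's legs -/

/-- [folklore] **THE FOUR-TERM WINDOW LEMMA** (the second-difference instance of §1 with ONE combined leg): legs `l₁ … l₄` with degree-2 letters at a
common centre (summability), a window letter of degree `s ≥ 2` for `l₁ − l₂ − l₃ + l₄`, and a degree-3 multiplier letter give
`Σ_{x∈X} |R₁ x − R₂ x − R₃ x + R₄ x| ≤ |ι|·162·aW·K`, `R_i x := Σ'_u Σ_α l_i x α u·W α u`. -/
theorem sum_abs_rem_four_le_of_window (X : Finset Pt) (l₁ l₂ l₃ l₄ : Pt → ι → Pt → ℝ)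
    {W : ι → Pt → ℝ} {a₀ aW K : ℝ} {p w : Pt} {s : ℕ} (hs : 2 ≤ s)
    (h₁ : ∀ x α u, |l₁ x α u| ≤ a₀ / ((supNorm (u - p) : ℝ) + 1) ^ 2)
    (h₂ : ∀ x α u, |l₂ x α u| ≤ a₀ / ((supNorm (u - p) : ℝ) + 1) ^ 2)
    (h₃ : ∀ x α u, |l₃ x α u| ≤ a₀ / ((supNorm (u - p) : ℝ) + 1) ^ 2)
    (h₄ : ∀ x α u, |l₄ x α u| ≤ a₀ / ((supNorm (u - p) : ℝ) + 1) ^ 2)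
    (hwin : ∀ α u, ∑ x ∈ X, |l₁ x α u - l₂ x α u - l₃ x α u + l₄ x α u| ≤ aW / ((supNorm (u - p) : ℝ) + 1) ^ s)
    (hW : ∀ α u, |W α u| ≤ K / ((supNorm (u - w) : ℝ) + 1) ^ 3) :
    ∑ x ∈ X, |(∑' u, ∑ α, l₁ x α u * W α u) - (∑' u, ∑ α, l₂ x α u * W α u) - (∑' u, ∑ α, l₃ x α u * W α u)
        + (∑' u, ∑ α, l₄ x α u * W α u)| ≤ (Fintype.card ι : ℝ) * 162 * aW * K := by
  -- the combined leg and its crude degree-2 letter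
  have hcomb : ∀ x α u, |l₁ x α u - l₂ x α u - l₃ x α u + l₄ x α u| ≤ 4 * a₀ / ((supNorm (u - p) : ℝ) + 1) ^ 2 := by
    intro x α u
    have e : 4 * a₀ / ((supNorm (u - p) : ℝ) + 1) ^ 2 = a₀ / ((supNorm (u - p) : ℝ) + 1) ^ 2 + a₀ / ((supNorm (u - p) : ℝ) + 1) ^ 2
        + a₀ / ((supNorm (u - p) : ℝ) + 1) ^ 2 + a₀ / ((supNorm (u - p) : ℝ) + 1) ^ 2 := by ring
    rw [e]
    calc |l₁ x α u - l₂ x α u - l₃ x α u + l₄ x α u| ≤ |l₁ x α u - l₂ x α u - l₃ x α u| + |l₄ x α u| := abs_add_le _ _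
      _ ≤ |l₁ x α u - l₂ x α u| + |l₃ x α u| + |l₄ x α u| := by linarith [abs_sub (l₁ x α u - l₂ x α u) (l₃ x α u)]
      _ ≤ |l₁ x α u| + |l₂ x α u| + |l₃ x α u| + |l₄ x α u| := by linarith [abs_sub (l₁ x α u) (l₂ x α u)]
      _ ≤ _ := by linarith [h₁ x α u, h₂ x α u, h₃ x α u, h₄ x α u]
  -- each `R_i x` is a convergent series; the four-term combination is the series of the combined leg
  have hS : ∀ (l : Pt → ι → Pt → ℝ), (∀ x α u, |l x α u| ≤ a₀ / ((supNorm (u - p) : ℝ) + 1) ^ 2) →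
      ∀ x, Summable (fun u => ∑ α, l x α u * W α u) :=
    fun l hl x => (abs_tsum_sum_mul_le (s := 2) (t := 3) (by norm_num) p w (hl x) hW).1
  have hid : ∀ x, (∑' u, ∑ α, l₁ x α u * W α u) - (∑' u, ∑ α, l₂ x α u * W α u) - (∑' u, ∑ α, l₃ x α u * W α u)
      + (∑' u, ∑ α, l₄ x α u * W α u) = ∑' u, ∑ α, (l₁ x α u - l₂ x α u - l₃ x α u + l₄ x α u) * W α u := by
    intro x
    rw [← (hS l₁ h₁ x).tsum_sub (hS l₂ h₂ x), ← ((hS l₁ h₁ x).sub (hS l₂ h₂ x)).tsum_sub (hS l₃ h₃ x),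
      ← (((hS l₁ h₁ x).sub (hS l₂ h₂ x)).sub (hS l₃ h₃ x)).tsum_add (hS l₄ h₄ x)]
    refine tsum_congr fun u => ?_
    rw [← Finset.sum_sub_distrib, ← Finset.sum_sub_distrib, ← Finset.sum_add_distrib]
    refine Finset.sum_congr rfl fun α _ => ?_
    ring
  -- §1 with a single combined leg (`m = 1`, coefficient `1`)
  have hmain := sum_abs_sum_rem_le_of_window' (ι := ι) X (fun _ : Fin 1 => (1 : ℝ))
    (fun x _ α u => l₁ x α u - l₂ x α u - l₃ x α u + l₄ x α u) (W := W) (s := s) hs (a₀ := 4 * a₀) (aW := aW) (p := p) (w := w)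
    (fun x _ α u => hcomb x α u)
    (fun α u => by simpa only [Finset.univ_unique, Fin.default_eq_zero, Finset.sum_singleton, one_mul] using hwin α u) hW
  simp only [Finset.univ_unique, Fin.default_eq_zero, Finset.sum_singleton, one_mul] at hmain
  calc ∑ x ∈ X, |(∑' u, ∑ α, l₁ x α u * W α u) - (∑' u, ∑ α, l₂ x α u * W α u) - (∑' u, ∑ α, l₃ x α u * W α u)
        + (∑' u, ∑ α, l₄ x α u * W α u)|
      = ∑ x ∈ X, |∑' u, ∑ α, (l₁ x α u - l₂ x α u - l₃ x α u + l₄ x α u) * W α u| := Finset.sum_congr rfl fun x _ => by rw [hid x]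
    _ ≤ (Fintype.card ι : ℝ) * 162 * aW * K := hmain

/-- [folklore] `quo n (n•w + r) = w + quo n r` (`n ≥ 1`). -/
theorem quo_nsmul_add {n : ℕ} (hn : 1 ≤ n) (w r : Pt) : quo n (n • w + r) = w + quo n r := by
  funext j
  have hn0 : (n : ℤ) ≠ 0 := by exact_mod_cast (show n ≠ 0 by omega)
  have e1 : (n • w + r) j = (n : ℤ) * w j + r j := by simp [nsmul_eq_mul]
  show (n • w + r) j / (n : ℤ) = w j + r j / (n : ℤ)
  rw [e1, show (n : ℤ) * w j + r j = r j + w j * (n : ℤ) by ring, Int.add_mul_ediv_right _ _ hn0]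
  ring

/-- [folklore] `‖r‖∞ ≤ 3n` ⟹ `‖quo n r‖∞ ≤ 3` (`n ≥ 1`). -/
theorem supNorm_quo_le_three {n : ℕ} (hn : 1 ≤ n) {r : Pt} (hr : supNorm r ≤ 3 * n) : supNorm (quo n r) ≤ 3 := by
  rw [supNorm_le_iff] at hr ⊢
  intro j
  have hj := natAbs_le_iff_mem.mp (hr j)
  have hn0 : (0 : ℤ) < n := by exact_mod_cast hn
  push_cast at hj
  refine natAbs_le_iff_mem.mpr ⟨?_, ?_⟩
  · show -((3 : ℕ) : ℤ) ≤ r j / (n : ℤ)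
    exact (Int.le_ediv_iff_mul_le hn0).mpr (by push_cast; linarith [hj.1])
  · show r j / (n : ℤ) ≤ ((3 : ℕ) : ℤ)
    have : r j / (n : ℤ) < 4 := (Int.ediv_lt_iff_lt_mul hn0).mpr (by linarith [hj.2])
    push_cast; omega

/-- [folklore] THE WINDOW's LEGS SHARE A CENTRE: for `q ∈ box 4 n` and a shift `t` with `‖t‖∞ ≤ 2`, the block of the fine point `n•w + q + t` is
within `3` of `w`, so a degree-2 letter centred at that block is a degree-2 letter centred at `w` with `16×` the constant. -/
theorem letter_recentre {n : ℕ} (hn : 1 ≤ n) {q t : Pt} (hq : q ∈ box 4 n) (ht : supNorm t ≤ 2) (w u : Pt) {c : ℝ} (hc : 0 ≤ c) :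
    c / ((supNorm (u - quo n (n • w + q + t)) : ℝ) + 1) ^ 2 ≤ 16 * c / ((supNorm (u - w) : ℝ) + 1) ^ 2 := by
  have hr : supNorm (q + t) ≤ 3 * n := by
    have h1 := Summit.QuantumFields.BalabanUV.Beta.FP.BlockAveragedKernel.supNorm_add_le_nat q t
    have hq' := mem_box_iff.mp hq
    omega
  have hquo : quo n (n • w + q + t) = w + quo n (q + t) := by rw [add_assoc, quo_nsmul_add hn]
  have h2 : supNorm (quo n (q + t)) ≤ 3 := supNorm_quo_le_three hn hr
  have htri : supNorm (u - w) ≤ supNorm (u - quo n (n • w + q + t)) + 3 := by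
    rw [hquo]
    have h := supNorm_le_supNorm_sub_add (u - w) (quo n (q + t))
    rw [show u - w - quo n (q + t) = u - (w + quo n (q + t)) by abel] at h
    omega
  have htri' : (supNorm (u - w) : ℝ) + 1 ≤ 4 * ((supNorm (u - quo n (n • w + q + t)) : ℝ) + 1) := by
    have : (supNorm (u - w) : ℝ) ≤ (supNorm (u - quo n (n • w + q + t)) : ℝ) + 3 := by exact_mod_cast htri
    linarith
  rw [div_le_div_iff₀ (by positivity) (by positivity)]
  have h16 : ((supNorm (u - w) : ℝ) + 1) ^ 2 ≤ 16 * ((supNorm (u - quo n (n • w + q + t)) : ℝ) + 1) ^ 2 := by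
    calc ((supNorm (u - w) : ℝ) + 1) ^ 2 ≤ (4 * ((supNorm (u - quo n (n • w + q + t)) : ℝ) + 1)) ^ 2 :=
          pow_le_pow_left₀ (by positivity) htri' 2
      _ = 16 * ((supNorm (u - quo n (n • w + q + t)) : ℝ) + 1) ^ 2 := by ring
  nlinarith [mul_nonneg hc (sub_nonneg.mpr h16)]

/-- [folklore] `‖e_i‖∞ ≤ 1 ≤ 2`, `‖e_ν + e_μ‖∞ ≤ 2`, `‖0‖∞ ≤ 2` — the four shifts of a second difference. -/
theorem supNorm_single_le_two (i : Fin 4) : supNorm (Pi.single i (1 : ℤ) : Pt) ≤ 2 := by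
  rw [supNorm_le_iff]; intro j
  by_cases hj : j = i
  · subst hj; simp
  · simp [hj]

/-- [folklore] `‖e_ν + e_μ‖∞ ≤ 2`. -/
theorem supNorm_single_add_single_le_two (ν μ : Fin 4) : supNorm (Pi.single ν (1 : ℤ) + Pi.single μ 1 : Pt) ≤ 2 :=
  (Summit.QuantumFields.BalabanUV.Beta.FP.BlockAveragedKernel.supNorm_add_le_nat _ _).trans
    (by have := supNorm_single_le_two ν; have := supNorm_single_le_two μ
        have h1 : supNorm (Pi.single ν (1 : ℤ) : Pt) ≤ 1 := by
          rw [supNorm_le_iff]; intro j; by_cases hj : j = ν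
          · subst hj; simp
          · simp [hj]
        have h2 : supNorm (Pi.single μ (1 : ℤ) : Pt) ≤ 1 := by
          rw [supNorm_le_iff]; intro j; by_cases hj : j = μ
          · subst hj; simp
          · simp [hj]
        omega)

/-! ## §2 (T2-win) for `R^Q` at the axial block average -/

section Axial

variable {P : Fin 4 → Fin 4 → Pt → ℝ} {C₀ C₁ κ : ℝ} {G : Fin 4 → Fin 4 → Pt → Pt → ℝ} {n : ℕ}

/-- **(T2-win) FOR `R^Q` AT `axialAvg`** [our bookkeeping]: under (P0), (P1), (G-poly κ), (G-inv), for every window block `w`, every source bond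
`(y, ν′)`, every target direction `μ′` and all difference directions `μ, ν`,
`Σ_{q∈box 4 n} |R^Q((n•w+q+e_ν+e_μ, μ′),(y,ν′)) − R^Q((n•w+q+e_ν, μ′),·) − R^Q((n•w+q+e_μ, μ′),·) + R^Q((n•w+q, μ′),·)|
   ≤ 4·162·(9·82944·C₁)·(4·1296·κ·(13824·531442·C₁∕n²) + 1)` — LOG-FREE, from (P1) alone; `O(1)` at `κ ≍ n²` (R-FP-20's window currency:
`n⁴` points × `O(n⁻⁴)`). -/
theorem sum_box_abs_remQ_fwdDiff₂_le
    (hP0 : ∀ μ α z, |P μ α z| ≤ C₀ / ((supNorm z : ℝ) + 1) ^ 2)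
    (hP1 : ∀ μ α (i : Fin 4) z, |P μ α (z + Pi.single i 1) - P μ α z| ≤ C₁ / ((supNorm z : ℝ) + 1) ^ 3)
    (hn : 1 ≤ n)
    (hG : ∀ α β u v, |G α β u v| ≤ κ / ((supNorm (u - v) : ℝ) + 1) ^ 5)
    (hinv : ∀ (w : Pt) (ν α : Fin 4) (u : Pt), HasSum
      (fun v => ∑ β, G α β u v * axialAvg n ν (fun y' => axialAvg n β (fun t => P ν β (y' - t)) v) w)
      (if u = w ∧ α = ν then 1 else 0))
    (μ' ν' μ ν : Fin 4) (w y : Pt) :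
    ∑ q ∈ box 4 n,
      |(∑' u, ∑ α, axialAvg n α (fun v => P μ' α (n • w + q + Pi.single ν 1 + Pi.single μ 1 - v)) u
            * ∑' v, ∑ β, G α β u v * axialAvg n β (fun t => P ν' β (y - t)) v)
        - (∑' u, ∑ α, axialAvg n α (fun v => P μ' α (n • w + q + Pi.single ν 1 - v)) u
            * ∑' v, ∑ β, G α β u v * axialAvg n β (fun t => P ν' β (y - t)) v)
        - (∑' u, ∑ α, axialAvg n α (fun v => P μ' α (n • w + q + Pi.single μ 1 - v)) u
            * ∑' v, ∑ β, G α β u v * axialAvg n β (fun t => P ν' β (y - t)) v)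
        + (∑' u, ∑ α, axialAvg n α (fun v => P μ' α (n • w + q - v)) u
            * ∑' v, ∑ β, G α β u v * axialAvg n β (fun t => P ν' β (y - t)) v)|
      ≤ (Fintype.card (Fin 4) : ℝ) * 162 * (9 * 82944 * C₁)
          * ((Fintype.card (Fin 4) : ℝ) * 1296 * κ * (13824 * 531442 * C₁ / (n : ℝ) ^ 2) + 1) := by
  have hC0 : 0 ≤ C₀ := letter_nonneg_of_le (hP0 μ' 0)
  have hn0 : (0 : ℝ) < n := by exact_mod_cast hn
  have ha0 : 0 ≤ 36 * 531442 * C₀ / (n : ℝ) ^ 2 := by positivity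
  -- degree-2 letters of the four legs with the COMMON centre `w` (the in-window legs; outside the window we use the in-window bound at `q := 0`)
  have hrec : ∀ (t : Pt), supNorm t ≤ 2 → ∀ q α u, |(if q ∈ box 4 n then axialAvg n α (fun v => P μ' α (n • w + q + t - v)) u else 0)|
      ≤ 16 * (36 * 531442 * C₀ / (n : ℝ) ^ 2) / ((supNorm (u - w) : ℝ) + 1) ^ 2 := by
    intro t ht q α u
    by_cases hq : q ∈ box 4 n
    · rw [if_pos hq]
      exact (leg_letter hP0 hn μ' (n • w + q + t) α u).trans (letter_recentre hn hq ht w u ha0)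
    · rw [if_neg hq, abs_zero]; positivity
  have hWle : ∀ α u, |∑' v, ∑ β, G α β u v * axialAvg n β (fun t => P ν' β (y - t)) v|
      ≤ ((Fintype.card (Fin 4) : ℝ) * 1296 * κ * (13824 * 531442 * C₁ / (n : ℝ) ^ 2) + 1)
          / ((supNorm (u - quo n y) : ℝ) + 1) ^ 3 := fun α u => abs_multQ_le hP1 hn hG hinv ν' y α u
  -- the window letter of §3, leg by leg in the window
  have hwin : ∀ α u, ∑ q ∈ box 4 n,
      |(if q ∈ box 4 n then axialAvg n α (fun v => P μ' α (n • w + q + (Pi.single ν 1 + Pi.single μ 1) - v)) u else 0)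
        - (if q ∈ box 4 n then axialAvg n α (fun v => P μ' α (n • w + q + Pi.single ν 1 - v)) u else 0)
        - (if q ∈ box 4 n then axialAvg n α (fun v => P μ' α (n • w + q + Pi.single μ 1 - v)) u else 0)
        + (if q ∈ box 4 n then axialAvg n α (fun v => P μ' α (n • w + q + 0 - v)) u else 0)|
      ≤ (9 * 82944 * C₁) / ((supNorm (u - w) : ℝ) + 1) ^ 3 := by
    intro α u
    have h := sum_box_abs_axialAvg_fwdDiff₂_le_profile μ ν (hP1 μ' α μ) hn α w u
    refine le_of_eq_of_le ?_ h
    refine Finset.sum_congr rfl fun q hq => ?_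
    simp only [if_pos hq, add_zero, ← add_assoc]
  -- the four-term window lemma at VARIABLE shifts (small terms for the unifier), then instantiated at `e_ν + e_μ, e_ν, e_μ, 0`
  have hgen : ∀ (t₁ t₂ t₃ t₄ : Pt), supNorm t₁ ≤ 2 → supNorm t₂ ≤ 2 → supNorm t₃ ≤ 2 → supNorm t₄ ≤ 2 →
      (∀ α u, ∑ q ∈ box 4 n,
        |(if q ∈ box 4 n then axialAvg n α (fun v => P μ' α (n • w + q + t₁ - v)) u else 0)
          - (if q ∈ box 4 n then axialAvg n α (fun v => P μ' α (n • w + q + t₂ - v)) u else 0)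
          - (if q ∈ box 4 n then axialAvg n α (fun v => P μ' α (n • w + q + t₃ - v)) u else 0)
          + (if q ∈ box 4 n then axialAvg n α (fun v => P μ' α (n • w + q + t₄ - v)) u else 0)|
        ≤ (9 * 82944 * C₁) / ((supNorm (u - w) : ℝ) + 1) ^ 3) →
      ∑ q ∈ box 4 n,
        |(∑' u, ∑ α, (if q ∈ box 4 n then axialAvg n α (fun v => P μ' α (n • w + q + t₁ - v)) u else 0)
              * ∑' v, ∑ β, G α β u v * axialAvg n β (fun t => P ν' β (y - t)) v)
          - (∑' u, ∑ α, (if q ∈ box 4 n then axialAvg n α (fun v => P μ' α (n • w + q + t₂ - v)) u else 0)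
              * ∑' v, ∑ β, G α β u v * axialAvg n β (fun t => P ν' β (y - t)) v)
          - (∑' u, ∑ α, (if q ∈ box 4 n then axialAvg n α (fun v => P μ' α (n • w + q + t₃ - v)) u else 0)
              * ∑' v, ∑ β, G α β u v * axialAvg n β (fun t => P ν' β (y - t)) v)
          + (∑' u, ∑ α, (if q ∈ box 4 n then axialAvg n α (fun v => P μ' α (n • w + q + t₄ - v)) u else 0)
              * ∑' v, ∑ β, G α β u v * axialAvg n β (fun t => P ν' β (y - t)) v)|
        ≤ (Fintype.card (Fin 4) : ℝ) * 162 * (9 * 82944 * C₁)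
            * ((Fintype.card (Fin 4) : ℝ) * 1296 * κ * (13824 * 531442 * C₁ / (n : ℝ) ^ 2) + 1) :=
    fun t₁ t₂ t₃ t₄ ht₁ ht₂ ht₃ ht₄ hw4 =>
      sum_abs_rem_four_le_of_window (ι := Fin 4) (box 4 n)
        (fun q α u => if q ∈ box 4 n then axialAvg n α (fun v => P μ' α (n • w + q + t₁ - v)) u else 0)
        (fun q α u => if q ∈ box 4 n then axialAvg n α (fun v => P μ' α (n • w + q + t₂ - v)) u else 0)
        (fun q α u => if q ∈ box 4 n then axialAvg n α (fun v => P μ' α (n • w + q + t₃ - v)) u else 0)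
        (fun q α u => if q ∈ box 4 n then axialAvg n α (fun v => P μ' α (n • w + q + t₄ - v)) u else 0)
        (W := fun α u => ∑' v, ∑ β, G α β u v * axialAvg n β (fun t => P ν' β (y - t)) v) (s := 3) (by norm_num)
        (p := w) (w := quo n y) (hrec t₁ ht₁) (hrec t₂ ht₂) (hrec t₃ ht₃) (hrec t₄ ht₄) hw4 hWle
  have h0 : supNorm (0 : Pt) ≤ 2 := by rw [supNorm_eq_zero_iff.mpr rfl]; norm_num
  have hmain := hgen (Pi.single ν 1 + Pi.single μ 1) (Pi.single ν 1) (Pi.single μ 1) 0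
    (supNorm_single_add_single_le_two ν μ) (supNorm_single_le_two ν) (supNorm_single_le_two μ) h0 hwin
  refine le_of_eq_of_le ?_ hmain
  refine Finset.sum_congr rfl fun q hq => ?_
  simp only [if_pos hq, add_zero, ← add_assoc]

end Axial

end

end Summit.QuantumFields.BalabanUV.Beta.FP.BlockAveragedRemainderWindowAxial
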